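import Literature.NumberTheory.Automorphic.EichlerEmbeddingLocalGlobal
import HarnessLib

/-!
# Orders of a quadratic subalgebra `ℚ(γ)` of a quaternion algebra are monogenic: `B = ℤ ⊕ ℤ σ₀`

Topic `NumberTheory/Automorphic`; theorems only (no definition, no named fact, no `sorry`),
continuing `EichlerEmbeddingLocalGlobal.lean` (`Brandt.IsQuadOrder γ B`: a finitely generated
subring-lattice `B ∋ 1, γ` of `ℚ(γ) ⊆ D` with `ℚ B = ℚ(γ)`). For a division quaternion algebra `D`
over `ℚ` and `γ ∉ ℚ`:

* `exists_rat_eq_of_mem_adjoin`, `rat_coords_unique` — every element of `ℚ(γ) = ℚ[γ]` is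
  `r + s γ` with unique `r, s ∈ ℚ` (`dim_ℚ ℚ[γ] = 2`, the tree's
  `finrank_adjoin_singleton_eq_two`);
* `adjoin_mul_eq` — the multiplication table `(r + sγ)(r' + s'γ) = (rr' - n ss') + (rs' + sr' + t ss') γ`,
  `t = trd γ`, `n = nrd γ` (`γ² = tγ - n`, `mul_self_eq_reducedTrace_mul_sub_reducedNorm`);
* `exists_forall_mem_iff_of_discrete` — a `ℤ`-submodule of `ℚ` containing `1` with bounded
  denominators is `(1/m) ℤ`;
* **`IsQuadOrder.exists_monogenic`** — an order `B` of `ℚ(γ)` through `γ` has a `ℤ`-basis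
  `(1, σ₀)`, `σ₀ = r₀ + γ/m` (Cox, *Primes of the form x² + ny²*, Lemma 7.2: "an order `𝒪` of
  conductor `f` is `ℤ + f𝒪_K = [1, f w_K]`"; here obtained directly: the `γ`-coordinates of `B` form
  the group `(1/m)ℤ` and `B ∩ ℚ = ℤ` because `B ∩ ℚ` is a finitely generated subring of `ℚ`);
* `IsQuadOrder.mem_localAt_iff_of_monogenic` — hence `B_(p) = ℤ_(p) ⊕ ℤ_(p) σ₀`.

These feed the local embedding numbers (`EichlerEmbeddingLocalSplit.lean`) and the discriminant /
class-number bookkeeping of the orders `B ⊇ ℤ[γ]` in Eichler's trace formula.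

## References

* [Cox2013] D. A. Cox, *Primes of the form x² + ny²*, 2nd ed. (2013), §7.A Lemma 7.2 and (7.2).
* [VignerasLNM800] M.-F. Vignéras, *Arithmétique des algèbres de quaternions*, LNM 800 (1980),
  Ch. I §1 (quadratic subalgebras `K(h)`), Ch. III §5 Cor. 5.14 (the orders `B ∋ h`).
-/

noncomputable section

open scoped Pointwise

universe u

namespace Literature.NumberTheory.Automorphic

namespace Brandt

variable {D : Type u} [Ring D] [Algebra ℚ D] [IsQuaternionAlgebra ℚ D]

/-! ### Rational coordinates on `ℚ(γ)` -/

section Coordinates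

/-- A quaternion algebra over `ℚ` is finite-dimensional. [folklore] -/
theorem finiteDimensional_of_isQuaternionAlgebra : FiniteDimensional ℚ D :=
  Module.finite_of_finrank_pos (by rw [IsQuaternionAlgebra.finrank_eq_four (K := ℚ) (D := D)]; norm_num)

/-- **Every element of `ℚ[γ]` is `r + sγ`** (`γ ∉ ℚ`, `D` a division quaternion algebra, so
`dim ℚ[γ] = 2`). [cite: VignerasLNM800, Ch. I §1] -/
theorem exists_rat_eq_of_mem_adjoin (hD : ∀ x : D, x ≠ 0 → IsUnit x) {γ : D}
    (hγ : γ ∉ (⊥ : Subalgebra ℚ D)) {w : D} (hw : w ∈ Algebra.adjoin ℚ {γ}) :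
    ∃ r s : ℚ, w = algebraMap ℚ D r + s • γ := by
  haveI : Nontrivial D := nontrivial_of_isQuaternionAlgebra
  haveI : FiniteDimensional ℚ D := finiteDimensional_of_isQuaternionAlgebra
  have h2 := finrank_adjoin_singleton_eq_two hD (IsQuaternionAlgebra.finrank_eq_four (K := ℚ)) hγ
  exact Subalgebra.exists_eq_add_smul_of_finrank_le_two _ h2.le
    (Algebra.self_mem_adjoin_singleton ℚ γ) hw hγ

/-- **Uniqueness of the coordinates** `r + sγ` (`γ ∉ ℚ`). [folklore] -/
theorem rat_coords_unique {γ : D} (hγ : γ ∉ (⊥ : Subalgebra ℚ D)) {r s r' s' : ℚ}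
    (h : algebraMap ℚ D r + s • γ = algebraMap ℚ D r' + s' • γ) : r = r' ∧ s = s' := by
  haveI : Nontrivial D := nontrivial_of_isQuaternionAlgebra
  have hs : s = s' := by
    by_contra hne
    have hne' : s - s' ≠ 0 := sub_ne_zero.mpr hne
    apply hγ
    have key : (s - s') • γ = algebraMap ℚ D (r' - r) := by
      rw [sub_smul, map_sub]
      rw [← sub_eq_zero] at h ⊢
      rw [← h]
      abel
    have : γ = algebraMap ℚ D ((s - s')⁻¹ * (r' - r)) := by
      rw [map_mul, ← key, Algebra.algebraMap_eq_smul_one, smul_mul_assoc, one_mul, smul_smul,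
        inv_mul_cancel₀ hne', one_smul]
    rw [this]
    exact Subalgebra.algebraMap_mem _ _
  subst hs
  refine ⟨?_, rfl⟩
  have h' : algebraMap ℚ D r = algebraMap ℚ D r' := add_right_cancel h
  exact (algebraMap ℚ D).injective h'

omit [IsQuaternionAlgebra ℚ D] in
/-- **Multiplication table of `ℚ[γ]`**: `(r + sγ)(r' + s'γ) = (rr' - n ss') + (rs' + sr' + t ss')γ`
with `t = trd γ`, `n = nrd γ` (from `γ² = tγ - n`). [cite: VignerasLNM800, Ch. I §1 Lemme 1.1] -/
theorem adjoin_mul_eq [IsQuaternionAlgebra ℚ D] (γ : D) (r s r' s' : ℚ) :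
    (algebraMap ℚ D r + s • γ) * (algebraMap ℚ D r' + s' • γ) =
      algebraMap ℚ D (r * r' - reducedNorm ℚ D γ * s * s') +
        (r * s' + s * r' + reducedTrace ℚ D γ * s * s') • γ := by
  have hγ2 : γ * γ = (reducedTrace ℚ D γ) • γ - (reducedNorm ℚ D γ) • (1 : D) := by
    rw [mul_self_eq_reducedTrace_mul_sub_reducedNorm ℚ D γ, Algebra.algebraMap_eq_smul_one,
      Algebra.algebraMap_eq_smul_one, smul_mul_assoc, one_mul]
  simp only [Algebra.algebraMap_eq_smul_one, add_mul, mul_add, smul_mul_assoc, mul_smul_comm,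
    one_mul, mul_one, hγ2, smul_sub, smul_smul]
  module

end Coordinates

/-! ### Discrete subgroups of `ℚ` -/

section Discrete

/-- **A `ℤ`-submodule of `ℚ` with bounded denominators containing `1` is `(1/m) ℤ`.** (Its image
under `x ↦ d x` is an ideal `(g)` of `ℤ`.) [folklore] -/
theorem exists_forall_mem_iff_of_discrete (S : Submodule ℤ ℚ) (h1 : (1 : ℚ) ∈ S) {d : ℕ}
    (hd : d ≠ 0) (hdS : ∀ s ∈ S, ∃ k : ℤ, (d : ℚ) * s = k) :
    ∃ m : ℕ, m ≠ 0 ∧ ∀ s : ℚ, s ∈ S ↔ ∃ k : ℤ, s = k / m := by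
  -- the ideal `I = {k : ℤ | k/d ∈ S}`
  let I : Submodule ℤ ℤ :=
    { carrier := {k : ℤ | (k : ℚ) / d ∈ S}
      add_mem' := fun {a b} ha hb => by
        simp only [Set.mem_setOf_eq, Int.cast_add, add_div] at *
        exact S.add_mem ha hb
      zero_mem' := by simp
      smul_mem' := fun c {a} ha => by
        simp only [Set.mem_setOf_eq, smul_eq_mul, Int.cast_mul] at *
        rw [mul_div_assoc, ← zsmul_eq_mul]
        exact S.smul_mem c ha }
  obtain ⟨g, hg⟩ := (IsPrincipalIdealRing.principal I).principal
  have hdq : (d : ℚ) ≠ 0 := Nat.cast_ne_zero.mpr hd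
  have hmemI : ∀ k : ℤ, k ∈ I ↔ (k : ℚ) / d ∈ S := fun k => Iff.rfl
  have hmemS : ∀ s : ℚ, s ∈ S ↔ ∃ j : ℤ, s = j * g / d := by
    intro s
    constructor
    · intro hs
      obtain ⟨k, hk⟩ := hdS s hs
      have hkI : k ∈ I := by rw [hmemI, ← hk, mul_div_cancel_left₀ _ hdq]; exact hs
      rw [hg, Submodule.mem_span_singleton] at hkI
      obtain ⟨j, rfl⟩ := hkI
      refine ⟨j, ?_⟩
      rw [← Int.cast_mul, ← smul_eq_mul, ← hk, mul_div_cancel_left₀ _ hdq]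
    · rintro ⟨j, rfl⟩
      have hgI : g ∈ I := by rw [hg]; exact Submodule.mem_span_singleton_self g
      rw [hmemI] at hgI
      have := S.smul_mem j hgI
      rwa [zsmul_eq_mul, ← mul_div_assoc] at this
  -- `1 ∈ S` forces `g/d = 1/j₁`
  obtain ⟨j₁, hj₁⟩ := (hmemS 1).mp h1
  have hprod : (j₁ : ℚ) * g = d := by
    rw [eq_div_iff hdq] at hj₁
    linarith
  have hj₁0 : (j₁ : ℚ) ≠ 0 := by
    intro h0
    rw [h0, zero_mul] at hprod
    exact hdq hprod.symm
  have hg0 : (g : ℚ) ≠ 0 := by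
    intro h0
    rw [h0, mul_zero] at hprod
    exact hdq hprod.symm
  have hgd : (g : ℚ) / d = 1 / j₁ := by
    rw [← hprod]
    field_simp
  have hjgd : ∀ j : ℤ, (j : ℚ) * g / d = j / j₁ := fun j => by
    rw [mul_div_assoc, hgd]
    ring
  refine ⟨j₁.natAbs, Int.natAbs_ne_zero.mpr (by exact_mod_cast hj₁0), fun s => ?_⟩
  rw [hmemS]
  have hcast : ((j₁.natAbs : ℕ) : ℚ) = |(j₁ : ℚ)| := by
    rw [Nat.cast_natAbs, Int.cast_abs]
  simp_rw [hjgd, hcast]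
  constructor
  · rintro ⟨j, rfl⟩
    rcases abs_choice (j₁ : ℚ) with habs | habs
    · exact ⟨j, by rw [habs]⟩
    · exact ⟨-j, by rw [habs]; push_cast; field_simp⟩
  · rintro ⟨k, rfl⟩
    rcases abs_choice (j₁ : ℚ) with habs | habs
    · exact ⟨k, by rw [habs]⟩
    · exact ⟨-k, by rw [habs]; push_cast; field_simp⟩

/-- **A finitely generated subring of `ℚ` is `ℤ`**: if `(1/m)(1/m) ∈ (1/m)ℤ` then `m = 1`. [folklore] -/
theorem natAbs_eq_one_of_mul_closed {m : ℕ} (hm : m ≠ 0)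
    (hmul : ∃ k : ℤ, (1 / m : ℚ) * (1 / m) = k / m) : m = 1 := by
  obtain ⟨k, hk⟩ := hmul
  have hmq : (m : ℚ) ≠ 0 := Nat.cast_ne_zero.mpr hm
  have : (k : ℚ) * m = 1 := by field_simp at hk; linarith
  have hkm : k * m = 1 := by exact_mod_cast this
  have := Int.eq_one_of_mul_eq_one_left (Int.natCast_nonneg m) hkm
  exact_mod_cast this

end Discrete

/-! ### Monogenicity of quadratic orders -/

section Monogenic

variable {γ : D} {B : Submodule ℤ D}

/-- **Quadratic orders are monogenic.** For a division quaternion algebra `D` over `ℚ`,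
`γ ∉ ℚ` and an order `B` of `ℚ(γ)` through `γ` (`IsQuadOrder γ B`) there are `r₀ ∈ ℚ` and
`m ≥ 1` such that `σ₀ = r₀ + γ/m ∈ B` and `B = ℤ ⊕ ℤ σ₀`, i.e. `b ∈ B ↔ b = u + v σ₀` with
`u, v ∈ ℤ` (Cox Lemma 7.2: `𝒪 = [1, f w_K]`). [cite: Cox2013, §7.A Lemma 7.2] -/
theorem IsQuadOrder.exists_monogenic (hD : ∀ x : D, x ≠ 0 → IsUnit x)
    (hγ : γ ∉ (⊥ : Subalgebra ℚ D)) (hB : IsQuadOrder γ B) :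
    ∃ (r₀ : ℚ) (m : ℕ), m ≠ 0 ∧ (algebraMap ℚ D r₀ + (m : ℚ)⁻¹ • γ) ∈ B ∧
      ∀ b : D, b ∈ B ↔ ∃ u v : ℤ, b = algebraMap ℚ D u + v • (algebraMap ℚ D r₀ + (m : ℚ)⁻¹ • γ) := by
  classical
  -- coordinates of the elements of `B`
  have hcoord : ∀ b ∈ B, ∃ r s : ℚ, b = algebraMap ℚ D r + s • γ := fun b hb =>
    exists_rat_eq_of_mem_adjoin hD hγ (hB.le_adjoin hb)
  -- a common denominator `d` for the coordinates of `B`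
  obtain ⟨d, hd0, hd⟩ : ∃ d : ℕ, d ≠ 0 ∧ ∀ b ∈ B, ∀ r s : ℚ, b = algebraMap ℚ D r + s • γ →
      (∃ k : ℤ, (d : ℚ) * r = k) ∧ ∃ k : ℤ, (d : ℚ) * s = k := by
    -- `B` is commensurable with `ℤ 1 ⊕ ℤ γ`: `d B ⊆ ℤ + ℤ γ` for some `d`
    have hZγ_le : Submodule.span ℤ ({1, γ} : Set D) ≤ adjoinLattice γ := by
      rw [Submodule.span_le]
      intro x hx
      rcases hx with h | h
      · rw [h]
        show (1 : D) ∈ adjoinLattice γ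
        rw [mem_adjoinLattice_iff]
        exact Subalgebra.one_mem _
      · rw [Set.mem_singleton_iff] at h
        rw [h]
        show γ ∈ adjoinLattice γ
        rw [mem_adjoinLattice_iff]
        exact Algebra.self_mem_adjoin_singleton ℚ γ
    have hZγ_full : ∀ z ∈ adjoinLattice γ, ∃ m : ℤ, m ≠ 0 ∧
        m • z ∈ Submodule.span ℤ ({1, γ} : Set D) := by
      intro z hz
      obtain ⟨r, s, rfl⟩ := exists_rat_eq_of_mem_adjoin hD hγ hz
      refine ⟨(r.den * s.den : ℕ), by exact_mod_cast mul_ne_zero r.den_nz s.den_nz, ?_⟩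
      rw [Submodule.mem_span_pair]
      refine ⟨r.num * s.den, s.num * r.den, ?_⟩
      have h1 : (r.den : ℚ) * r = r.num := Rat.den_mul_eq_num r
      have h2 : (s.den : ℚ) * s = s.num := Rat.den_mul_eq_num s
      have e1 : ((r.num * s.den : ℤ) : ℚ) = ((r.den * s.den : ℕ) : ℚ) * r := by
        push_cast; rw [← h1]; ring
      have e2 : ((s.num * r.den : ℤ) : ℚ) = ((r.den * s.den : ℕ) : ℚ) * s := by
        push_cast; rw [← h2]; ring
      rw [natCast_zsmul, ← Nat.cast_smul_eq_nsmul ℚ, ← Int.cast_smul_eq_zsmul ℚ (r.num * s.den),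
        ← Int.cast_smul_eq_zsmul ℚ (s.num * r.den), e1, e2, smul_add, Algebra.algebraMap_eq_smul_one,
        smul_smul, smul_smul]
    obtain ⟨d, hd0, hdB⟩ := IsQuadOrder.exists_nat_smul_mem_of_full hZγ_full hB.fg hB.le_adjoin
    refine ⟨d, hd0, fun b hb r s hbrs => ?_⟩
    have hmem := hdB b hb
    rw [hbrs, Submodule.mem_span_pair] at hmem
    obtain ⟨k₁, k₂, hk⟩ := hmem
    have hk' : algebraMap ℚ D (k₁ : ℚ) + (k₂ : ℚ) • γ =
        algebraMap ℚ D ((d : ℚ) * r) + ((d : ℚ) * s) • γ := by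
      calc algebraMap ℚ D (k₁ : ℚ) + (k₂ : ℚ) • γ = k₁ • (1 : D) + k₂ • γ := by
            rw [Algebra.algebraMap_eq_smul_one, Int.cast_smul_eq_zsmul, Int.cast_smul_eq_zsmul]
        _ = (d : ℤ) • (algebraMap ℚ D r + s • γ) := hk
        _ = algebraMap ℚ D ((d : ℚ) * r) + ((d : ℚ) * s) • γ := by
            rw [← Int.cast_smul_eq_zsmul ℚ, smul_add, Algebra.algebraMap_eq_smul_one,
              Algebra.algebraMap_eq_smul_one, smul_smul, smul_smul]
            push_cast
            ring_nf
    obtain ⟨h₁, h₂⟩ := rat_coords_unique hγ hk'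
    exact ⟨⟨k₁, h₁.symm⟩, ⟨k₂, h₂.symm⟩⟩
  -- the submodule `S` of `γ`-coordinates and `T` of rational elements
  let S : Submodule ℤ ℚ :=
    { carrier := {s : ℚ | ∃ r : ℚ, algebraMap ℚ D r + s • γ ∈ B}
      add_mem' := fun {a b} ⟨r, hr⟩ ⟨r', hr'⟩ => ⟨r + r', by
        have := B.add_mem hr hr'
        rwa [add_add_add_comm, ← map_add, ← add_smul] at this⟩
      zero_mem' := ⟨0, by rw [map_zero, zero_smul, add_zero]; exact B.zero_mem⟩
      smul_mem' := fun c {a} ⟨r, hr⟩ => ⟨c • r, by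
        show algebraMap ℚ D (c • r) + (c • a) • γ ∈ B
        rw [map_zsmul, smul_assoc, ← smul_add]
        exact B.smul_mem c hr⟩ }
  let T : Submodule ℤ ℚ :=
    { carrier := {r : ℚ | algebraMap ℚ D r ∈ B}
      add_mem' := fun {a b} ha hb => by
        simp only [Set.mem_setOf_eq, map_add]
        exact B.add_mem ha hb
      zero_mem' := by simp only [Set.mem_setOf_eq, map_zero]; exact B.zero_mem
      smul_mem' := fun c {a} ha => by
        simp only [Set.mem_setOf_eq, map_zsmul]
        exact B.smul_mem c ha }
  have hSmem : ∀ s : ℚ, s ∈ S ↔ ∃ r : ℚ, algebraMap ℚ D r + s • γ ∈ B := fun s => Iff.rfl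
  have hTmem : ∀ r : ℚ, r ∈ T ↔ algebraMap ℚ D r ∈ B := fun r => Iff.rfl
  have hS1 : (1 : ℚ) ∈ S := ⟨0, by rw [map_zero, zero_add, one_smul]; exact hB.gen_mem⟩
  have hT1 : (1 : ℚ) ∈ T := by rw [hTmem, map_one]; exact hB.one_mem
  have hSd : ∀ s ∈ S, ∃ k : ℤ, (d : ℚ) * s = k := fun s ⟨r, hr⟩ => (hd _ hr r s rfl).2
  have hTd : ∀ r ∈ T, ∃ k : ℤ, (d : ℚ) * r = k := fun r hr =>
    (hd _ hr r 0 (by rw [zero_smul, add_zero])).1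
  obtain ⟨m, hm0, hmS⟩ := exists_forall_mem_iff_of_discrete S hS1 hd0 hSd
  obtain ⟨m', hm'0, hm'T⟩ := exists_forall_mem_iff_of_discrete T hT1 hd0 hTd
  -- `T` is a ring, so `m' = 1`
  have hm'1 : m' = 1 := by
    refine natAbs_eq_one_of_mul_closed hm'0 ?_
    have h1m : (1 / m' : ℚ) ∈ T := (hm'T _).mpr ⟨1, by push_cast; ring⟩
    have hsq : (1 / m' : ℚ) * (1 / m') ∈ T := by
      rw [hTmem, map_mul]
      exact hB.mul_mem _ ((hTmem _).mp h1m) _ ((hTmem _).mp h1m)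
    exact (hm'T _).mp hsq
  -- the generator `σ₀ = r₀ + γ/m`
  have hσS : (m : ℚ)⁻¹ ∈ S := (hmS _).mpr ⟨1, by push_cast; ring⟩
  obtain ⟨r₀, hr₀⟩ := hσS
  refine ⟨r₀, m, hm0, hr₀, fun b => ⟨fun hb => ?_, ?_⟩⟩
  · obtain ⟨r, s, rfl⟩ := hcoord b hb
    have hs : s ∈ S := ⟨r, hb⟩
    obtain ⟨v, hv⟩ := (hmS s).mp hs
    -- `b - v σ₀ ∈ B ∩ ℚ = ℤ`
    have e : algebraMap ℚ D r + s • γ - v • (algebraMap ℚ D r₀ + (m : ℚ)⁻¹ • γ) =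
        algebraMap ℚ D (r - v * r₀) := by
      rw [hv, ← Int.cast_smul_eq_zsmul ℚ v, smul_add, smul_smul, Algebra.algebraMap_eq_smul_one,
        Algebra.algebraMap_eq_smul_one, Algebra.algebraMap_eq_smul_one, div_eq_mul_inv]
      module
    have hdiff : algebraMap ℚ D (r - v * r₀) ∈ B := by
      have h := B.sub_mem hb (B.smul_mem v hr₀)
      rwa [e] at h
    have hT : r - v * r₀ ∈ T := (hTmem _).mpr hdiff
    rw [hm'T, hm'1] at hT
    obtain ⟨u, hu⟩ := hT
    rw [Nat.cast_one, div_one] at hu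
    refine ⟨u, v, ?_⟩
    rw [← hu, ← Int.cast_smul_eq_zsmul ℚ v, hv, smul_add, smul_smul,
      Algebra.algebraMap_eq_smul_one, Algebra.algebraMap_eq_smul_one,
      Algebra.algebraMap_eq_smul_one, div_eq_mul_inv]
    module
  · rintro ⟨u, v, rfl⟩
    refine B.add_mem ?_ (B.smul_mem v hr₀)
    have : algebraMap ℚ D (u : ℚ) = (u : ℤ) • (1 : D) := by
      rw [Algebra.algebraMap_eq_smul_one, Int.cast_smul_eq_zsmul]
    rw [this]
    exact B.smul_mem u hB.one_mem

omit [IsQuaternionAlgebra ℚ D] in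
/-- **Localisation of a monogenic order**: with `σ₀` as above, `y ∈ B_(p)` iff `y = u + v σ₀` with
`u, v ∈ ℤ_(p)`, i.e. rationals whose denominators are prime to `p`. [folklore] -/
theorem IsQuadOrder.mem_localAt_iff_of_monogenic {σ₀ : D}
    (hBσ : ∀ b : D, b ∈ B ↔ ∃ u v : ℤ, b = algebraMap ℚ D u + v • σ₀) (p : ℕ) (y : D) :
    y ∈ localAt p B ↔
      ∃ u v : ℚ, u.den.Coprime p ∧ v.den.Coprime p ∧ y = algebraMap ℚ D u + v • σ₀ := by
  constructor
  · rintro ⟨k, hk0, hk, hky⟩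
    obtain ⟨u, v, huv⟩ := (hBσ _).mp hky
    have hkq : (k : ℚ) ≠ 0 := Nat.cast_ne_zero.mpr hk0
    have hden : ∀ w : ℤ, ((w : ℚ) / k).den ∣ k := fun w => by
      have h := Rat.den_dvd w k
      rw [Rat.divInt_eq_div] at h
      push_cast at h
      exact_mod_cast h
    refine ⟨u / k, v / k, Nat.Coprime.coprime_dvd_left (hden u) hk,
      Nat.Coprime.coprime_dvd_left (hden v) hk, ?_⟩
    have hy : y = (k : ℚ)⁻¹ • ((k : ℤ) • y) := by
      rw [← Int.cast_smul_eq_zsmul ℚ, smul_smul]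
      push_cast
      rw [inv_mul_cancel₀ hkq, one_smul]
    rw [hy, huv, ← Int.cast_smul_eq_zsmul ℚ v, smul_add, smul_smul, Algebra.algebraMap_eq_smul_one,
      Algebra.algebraMap_eq_smul_one, smul_smul, div_eq_inv_mul, div_eq_inv_mul]
  · rintro ⟨u, v, hu, hv, rfl⟩
    refine ⟨u.den * v.den, mul_ne_zero u.den_nz v.den_nz, Nat.Coprime.mul_left hu hv, ?_⟩
    rw [hBσ]
    refine ⟨u.num * v.den, v.num * u.den, ?_⟩
    have h1 : (u.den : ℚ) * u = u.num := Rat.den_mul_eq_num u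
    have h2 : (v.den : ℚ) * v = v.num := Rat.den_mul_eq_num v
    have e1 : ((u.num * v.den : ℤ) : ℚ) = ((u.den * v.den : ℕ) : ℚ) * u := by
      push_cast; rw [← h1]; ring
    have e2 : ((v.num * u.den : ℤ) : ℚ) = ((u.den * v.den : ℕ) : ℚ) * v := by
      push_cast; rw [← h2]; ring
    rw [natCast_zsmul, ← Nat.cast_smul_eq_nsmul ℚ, ← Int.cast_smul_eq_zsmul ℚ (v.num * u.den),
      e1, e2, smul_add, Algebra.algebraMap_eq_smul_one, Algebra.algebraMap_eq_smul_one, smul_smul,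
      smul_smul]

end Monogenic

end Brandt

end Literature.NumberTheory.Automorphic

end
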